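import Mathlib
import HarnessLib
import Summits.FinalStateConjecture.FinalStateConjecture.Statement
import Literature.Geometry.Lorentzian.NullRayNonImprisonment
import Literature.Geometry.Lorentzian.TimelikeRayCauchy
import Literature.Geometry.Lorentzian.CauchyDevelopmentGlobalHyperbolicityProofs
import Literature.Geometry.Lorentzian.HypersurfaceRestriction

/-!
# Crux `RecurrentlyFlatDisperses` (stmt-FinalStateConjecture-14665), line `Sketch`
# (card `outgoing-blind-cup-restart`) — registered stub `stub_chartFuture`

CHART TIME RUNS TO THE FUTURE: given the pointwise anchor (`AnchorCone`, first hypothesis), on the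
late region `{x⁰ > τ₀}` the push-forward `dΨ₀(∂₀)` of the coordinate time direction is
future-directed for the development's time orientation. It is timelike by the anchor
(`g(dΨ₀∂₀, dΨ₀∂₀) ≤ -1 + 1/4`); were it past-directed at one point `x` it would stay past-directed
along the vertical ray `γ(t) = Ψ₀(x + δ(eᵗ - 1) ∂₀)`, `t ≥ 0`, `δ = x⁰ - τ₀` (continuity of
`g(T, γ')`, which never vanishes: a causal vector is never orthogonal to a timelike one, O'Neill
1983, Ch. 5, Lemma 26), making `γ` a past-directed timelike ray with `g(γ', γ') ≤ -(3/4)δ²`, hence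
past-ENDLESS (`TimeOrientation.isFutureEndless_Ici_of_val_velocity_le` for the reversed
orientation) and contained in `J⁻(Ψ₀ x) ∩ J⁺(Σ)` (the chart image lies in `O ⊆ J⁺(Σ)`), a compact
set (`CauchyDevelopment.isCompact_causalPast_inter_causalFuture_range`) — contradicting
non-imprisonment in the strongly causal development
(`IsStronglyCausal.exists_forall_notMem_of_isCompact_holds` for the reversed orientation, strong
causality of `-T` from `IsGloballyHyperbolic.reverse` and Bernal–Sánchez 2007, Thm. 3.2). The
pattern is that of `Spacetime.exists_forall_notMem_of_isGeodesicOn_of_isNull`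
(`NullRayNonImprisonment.lean`). Mathlib + the Literature cone only; no definitions, no named facts.
-/

noncomputable section

open scoped Manifold ContDiff Topology
open Bundle Filter Set TopologicalSpace Literature.Geometry.Lorentzian

namespace Summit.FinalStateConjecture.FinalStateConjecture.Theorems.RecurrentlyFlatDisperses

/-! ### Regularity side conditions -/

/-- `2 ≤ ∞` in `ℕ∞ω` (regularity side condition of the causality theorems). -/
private lemma two_le_infty : (2 : ℕ∞ω) ≤ ∞ := WithTop.coe_le_coe.mpr le_top

/-- `1 ≤ ∞` in `ℕ∞ω`. -/
private lemma one_le_infty : (1 : ℕ∞ω) ≤ ∞ := WithTop.coe_le_coe.mpr le_top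

/-! ### A past-directed timelike ray of speed bounded below cannot stay in `J⁺(S)` -/

section PastRay

variable {E : Type*} [NormedAddCommGroup E] [NormedSpace ℝ E] {H : Type*} [TopologicalSpace H]
  {I : ModelWithCorners ℝ E H} {n : ℕ∞ω} {M : Type*} [TopologicalSpace M] [ChartedSpace H M]
  [IsManifold I ∞ M]

/-- **No past-directed timelike ray with `g(γ', γ') ≤ -k < 0` stays in `J⁺(S)` when all the sets
`J⁻(x) ∩ J⁺(S)` are compact and `(g, τ)` is globally hyperbolic.** Read for the reversed time
orientation `-T`, the ray `γ|[0, ∞)` is a future causal curve which is future endless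
(`TimeOrientation.isFutureEndless_Ici_of_val_velocity_le`: the speed bound forbids a limit point),
every `γ t`, `t > 0`, lies in `J⁻(γ 0)` (along `γ|[0, t]`) and in `J⁺(S)`, so the ray is imprisoned
in the compact set `J⁻(γ 0) ∩ J⁺(S)`; but `(g, -T)` is globally hyperbolic
(`IsGloballyHyperbolic.reverse`), hence strongly causal (Bernal–Sánchez 2007, Thm. 3.2), and strong
causality forbids partial imprisonment of future-endless causal curves in compact sets (O'Neill
1983, Ch. 14, Lemma 13; `IsStronglyCausal.exists_forall_notMem_of_isCompact_holds`). -/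
private theorem false_of_pastRay_subset_causalFuture [T2Space M] [SecondCountableTopology M]
    [ConnectedSpace M] [I.Boundaryless] [FiniteDimensional ℝ E] {g : LorentzianMetric I n M}
    {τ : TimeOrientation g} (hn : 2 ≤ n) (hgh : g.IsGloballyHyperbolic τ) {S : Set M}
    (hK : ∀ x : M, IsCompact (g.causalPast τ {x} ∩ g.causalFuture τ S)) {γ : ℝ → M} {k : ℝ}
    (hk : 0 < k)
    (hγ : ∀ s : ℝ, 0 ≤ s → MDifferentiableAt 𝓘(ℝ, ℝ) I γ s ∧
      g.val (γ s) (velocity I γ s) (velocity I γ s) ≤ -k ∧ τ.IsPastDirected (velocity I γ s))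
    (hmem : ∀ s : ℝ, 0 ≤ s → γ s ∈ g.causalFuture τ S) : False := by
  haveI : BoundarylessManifold I M := inferInstance
  have hn1 : (1 : ℕ∞ω) ≤ n := le_trans (by norm_num) hn
  -- `γ|[0, ∞)` is a future causal curve for `-T`
  have hcurve : g.IsFutureCausalCurveOn τ.reverse γ (Ici 0) := fun t ht ↦
    ⟨(hγ t ht).1, (TimeOrientation.isFutureDirected_reverse_iff _ _).mpr (hγ t ht).2.2⟩
  -- it is future endless (for `-T`)
  have hend : IsFutureEndless γ (Ici 0) :=
    τ.reverse.isFutureEndless_Ici_of_val_velocity_le hn1 hk fun s hs ↦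
      ⟨(hγ s hs).1, (hγ s hs).2.1,
        (TimeOrientation.isFutureDirected_reverse_iff _ _).mpr (hγ s hs).2.2⟩
  -- `(g, -T)` is strongly causal
  have hsc : g.IsStronglyCausal τ.reverse :=
    LorentzianMetric.bernalSanchez_isStronglyCausal_of_isGloballyHyperbolic_holds g τ.reverse hn
      hgh.reverse
  -- non-imprisonment in `J⁻(γ 0) ∩ J⁺(S)`
  obtain ⟨t₁, ht₁, hout⟩ :=
    LorentzianMetric.IsStronglyCausal.exists_forall_notMem_of_isCompact_holds hn hsc (hK (γ 0))
      ordConnected_Ici hcurve hend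
  have ht₁' : (0 : ℝ) ≤ t₁ := ht₁
  have hpos : (0 : ℝ) < t₁ + 1 := by linarith
  refine hout (t₁ + 1) (mem_Ici.mpr hpos.le) (by linarith) ⟨?_, hmem _ hpos.le⟩
  -- `γ (t₁ + 1) ∈ J⁻(γ 0) = J⁺_{-T}(γ 0)`, along `γ|[0, t₁ + 1]`
  exact Or.inr ⟨γ 0, mem_singleton _, γ, 0, t₁ + 1, hpos, hcurve.mono Icc_subset_Ici_self, rfl, rfl⟩

end PastRay

/-! ### The anchored chart: `dΨ(∂₀)` is uniformly timelike -/

/-- **Pointwise consequence of the `C⁰` anchor**: if `‖Ψ^* g − η‖ ≤ 1/4` at `y` (operator norm on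
`E4`), then `g(dΨ ∂₀, dΨ ∂₀) = η(∂₀, ∂₀) + (Ψ^* g − η)(∂₀, ∂₀) ≤ -1 + 1/4 = -3/4`
(`Spacetime.deviation_apply`, `Minkowski.bilin_basisVector_zero`, `‖∂₀‖ = 1`). -/
private theorem val_mfderiv_basisVector_zero_le {𝓢 : Spacetime 4} {U₀ : Opens E4}
    (Ψ : U₀ → 𝓢.carrier) (y : U₀)
    (h : ‖𝓢.deviation (Minkowski.backgroundOn U₀) Ψ y‖ ≤ 1 / 4) :
    𝓢.metric.val (Ψ y) (mfderiv 𝓘(ℝ, E4) (𝓡 4) Ψ y (E4.basisVector 0))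
      (mfderiv 𝓘(ℝ, E4) (𝓡 4) Ψ y (E4.basisVector 0)) ≤ -(3 / 4) := by
  have h1 := 𝓢.deviation_apply (Minkowski.backgroundOn U₀) Ψ y (E4.basisVector 0)
    (E4.basisVector 0)
  have h2 : (Minkowski.backgroundOn U₀).bilin y.1 (E4.basisVector 0) (E4.basisVector 0) = -1 :=
    Minkowski.bilin_basisVector_zero
  have hn : ‖(E4.basisVector 0 : E4)‖ = 1 := by simp [E4.basisVector]
  have h3 : ‖𝓢.deviation (Minkowski.backgroundOn U₀) Ψ y (E4.basisVector 0) (E4.basisVector 0)‖ ≤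
      1 / 4 := by
    refine (ContinuousLinearMap.le_opNorm₂ _ _ _).trans ?_
    rw [hn, mul_one, mul_one]
    exact h
  rw [Real.norm_eq_abs] at h3
  have h4 := (le_abs_self _).trans h3
  rw [h1, h2] at h4
  exact (sub_le_iff_le_add.mp h4).trans (by norm_num)

/-! ### The vertical exponential ray of the chart -/

/-- The chart-vertical curve `s ↦ x₀ + δ(eˢ - 1) ∂₀` of `E4` (through `x₀` at `s = 0`, time
coordinate `x₀⁰ + δ(eˢ - 1) > x₀⁰ - δ`, speed `δ eˢ ≥ δ` for `s ≥ 0`) has derivative `δ eᵗ ∂₀`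
at `t`. -/
private theorem hasDerivAt_vert (x₀ : E4) (δ t : ℝ) :
    HasDerivAt (fun s : ℝ ↦ x₀ + (δ * (Real.exp s - 1)) • (E4.basisVector 0 : E4))
      ((δ * Real.exp t) • (E4.basisVector 0 : E4)) t := by
  have h1 : HasDerivAt (fun s : ℝ ↦ δ * (Real.exp s - 1)) (δ * Real.exp t) t := by
    simpa using ((Real.hasDerivAt_exp t).sub_const 1).const_mul δ
  simpa using (h1.smul_const (E4.basisVector 0 : E4)).const_add x₀

/-- The time coordinate along the chart-vertical curve is `x₀⁰ + δ(eˢ - 1)`. -/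
private theorem vert_apply_zero (x₀ : E4) (δ s : ℝ) :
    (x₀ + (δ * (Real.exp s - 1)) • (E4.basisVector 0 : E4)) 0 = x₀ 0 + δ * (Real.exp s - 1) := by
  simp [E4.basisVector]

/-- The chart-vertical curve is smooth (as a map `ℝ → E4`). -/
private theorem contDiff_vert (x₀ : E4) (δ : ℝ) :
    ContDiff ℝ ∞ (fun s : ℝ ↦ x₀ + (δ * (Real.exp s - 1)) • (E4.basisVector 0 : E4)) :=
  contDiff_const.add ((contDiff_const.mul (Real.contDiff_exp.sub contDiff_const)).smul
    contDiff_const)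

/-- The velocity of the chart-vertical curve (as a curve in the manifold `E4`) is `δ eᵗ ∂₀`. -/
private theorem velocity_vert (x₀ : E4) (δ t : ℝ) :
    velocity 𝓘(ℝ, E4) (fun s : ℝ ↦ x₀ + (δ * (Real.exp s - 1)) • (E4.basisVector 0 : E4)) t =
      (δ * Real.exp t) • (E4.basisVector 0 : E4) := by
  simp only [velocity]
  rw [mfderiv_eq_fderiv, ← toSpanSingleton_deriv, (hasDerivAt_vert x₀ δ t).deriv]
  exact one_smul ℝ _

/-- `B(a • w, a • w) = a² B(w, w)` for the metric at a point. -/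
private theorem val_smul_smul {E : Type*} [NormedAddCommGroup E] [NormedSpace ℝ E] {H : Type*}
    [TopologicalSpace H] {I : ModelWithCorners ℝ E H} {n : ℕ∞ω} {M : Type*} [TopologicalSpace M]
    [ChartedSpace H M] [IsManifold I ∞ M] (g : LorentzianMetric I n M) (x : M) (a : ℝ)
    (w : TangentSpace I x) : g.val x (a • w) (a • w) = a * a * g.val x w w := by
  rw [map_smul, map_smul, smul_apply, smul_eq_mul, smul_eq_mul, mul_assoc]

/-- `B(u, a • w) = a B(u, w)` for the metric at a point. -/
private theorem val_smul_right {E : Type*} [NormedAddCommGroup E] [NormedSpace ℝ E] {H : Type*}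
    [TopologicalSpace H] {I : ModelWithCorners ℝ E H} {n : ℕ∞ω} {M : Type*} [TopologicalSpace M]
    [ChartedSpace H M] [IsManifold I ∞ M] (g : LorentzianMetric I n M) (x : M)
    (u : TangentSpace I x) (a : ℝ) (w : TangentSpace I x) :
    g.val x u (a • w) = a * g.val x u w := by
  rw [map_smul, smul_eq_mul]

/-- Chain rule for velocities: `(f ∘ γ)'(t) = df_{γ t}(γ' t)` (copy of `velocity_comp` of
`GaussFormulaTangential.lean`, to keep the imports light). -/
private theorem velocity_comp' {E' : Type*} [NormedAddCommGroup E'] [NormedSpace ℝ E']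
    {H' : Type*} [TopologicalSpace H'] {I' : ModelWithCorners ℝ E' H'} {N : Type*}
    [TopologicalSpace N] [ChartedSpace H' N]
    {E : Type*} [NormedAddCommGroup E] [NormedSpace ℝ E] {H : Type*} [TopologicalSpace H]
    {I : ModelWithCorners ℝ E H} {M : Type*} [TopologicalSpace M] [ChartedSpace H M]
    {f : N → M} {γ : ℝ → N} {t : ℝ} (hf : MDifferentiableAt I' I f (γ t))
    (hγ : MDifferentiableAt 𝓘(ℝ, ℝ) I' γ t) :
    velocity I (f ∘ γ) t = mfderiv I' I f (γ t) (velocity I' γ t) := by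
  simp only [velocity]
  rw [mfderiv_comp t hf hγ]
  rfl

/-- **The lifted vertical ray and its velocity.** For a smooth chart map `Ψ : U₀ → 𝓢` and a curve
`c : ℝ → U₀` whose underlying `E4`-curve is the chart-vertical curve `s ↦ x₀ + δ(eˢ - 1) ∂₀`, the
lift `Ψ ∘ c` is smooth and its velocity at `t` is `δ eᵗ · dΨ_{c t}(∂₀)` (chain rule; the inclusion
`U₀ ↪ E4` has identity differential, `mfderiv_subtypeVal`). -/
private theorem vertical_lift {𝓢 : Spacetime 4} {U₀ : Opens E4} {Ψ : U₀ → 𝓢.carrier}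
    (hΨ : ContMDiff 𝓘(ℝ, E4) (𝓡 4) ∞ Ψ) (x₀ : E4) (δ : ℝ) {c : ℝ → U₀}
    (hc : ∀ s : ℝ, (c s : E4) = x₀ + (δ * (Real.exp s - 1)) • (E4.basisVector 0 : E4)) :
    ContMDiff 𝓘(ℝ, ℝ) (𝓡 4) ∞ (Ψ ∘ c) ∧ ∀ t : ℝ, MDifferentiableAt 𝓘(ℝ, ℝ) (𝓡 4) (Ψ ∘ c) t ∧
      velocity (𝓡 4) (Ψ ∘ c) t =
        (δ * Real.exp t) • mfderiv 𝓘(ℝ, E4) (𝓡 4) Ψ (c t) (E4.basisVector 0) := by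
  have hcv :
      Subtype.val ∘ c = (fun s : ℝ ↦ x₀ + (δ * (Real.exp s - 1)) • (E4.basisVector 0 : E4)) :=
    funext hc
  have hp_smooth : ContMDiff 𝓘(ℝ, ℝ) 𝓘(ℝ, E4) ∞
      (fun s : ℝ ↦ x₀ + (δ * (Real.exp s - 1)) • (E4.basisVector 0 : E4)) :=
    contMDiff_iff_contDiff.mpr (contDiff_vert x₀ δ)
  have hc_smooth : ContMDiff 𝓘(ℝ, ℝ) 𝓘(ℝ, E4) ∞ c :=
    (ContMDiff.subtypeVal_comp_iff U₀ c).mp (hcv ▸ hp_smooth)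
  have hγ : ContMDiff 𝓘(ℝ, ℝ) (𝓡 4) ∞ (Ψ ∘ c) := hΨ.comp hc_smooth
  refine ⟨hγ, fun t ↦ ⟨hγ.mdifferentiableAt (by simp), ?_⟩⟩
  have hct : MDifferentiableAt 𝓘(ℝ, ℝ) 𝓘(ℝ, E4) c t := hc_smooth.mdifferentiableAt (by simp)
  have hΨt : MDifferentiableAt 𝓘(ℝ, E4) (𝓡 4) Ψ (c t) := hΨ.mdifferentiableAt (by simp)
  -- velocity of `c` = velocity of the `E4`-curve (identity differential of the inclusion)
  have hvc : velocity 𝓘(ℝ, E4) c t = (δ * Real.exp t) • (E4.basisVector 0 : E4) := by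
    have h1 : velocity 𝓘(ℝ, E4) (Subtype.val ∘ c) t =
        mfderiv 𝓘(ℝ, E4) 𝓘(ℝ, E4) (Subtype.val : U₀ → E4) (c t) (velocity 𝓘(ℝ, E4) c t) :=
      velocity_comp' (hasMFDerivAt_subtypeVal (c t)).mdifferentiableAt hct
    rw [mfderiv_subtypeVal, hcv, velocity_vert] at h1
    exact h1.symm
  rw [velocity_comp' hΨt hct, hvc]
  exact (mfderiv 𝓘(ℝ, E4) (𝓡 4) Ψ (c t)).map_smul (δ * Real.exp t) (E4.basisVector 0)

/-! ### The stub -/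

/-- **Chart time runs to the future** (registered stub `stub_chartFuture` of crux
stmt-FinalStateConjecture-14665, `AnchorCone → ChartFuture` unfolded). -/
theorem stub_chartFuture :
    (∀ (X : Type) [TopologicalSpace X] [ChartedSpace E3 X] [IsManifold (𝓡 3) ∞ X] [T2Space X]
      [SecondCountableTopology X] [ConnectedSpace X],
      ∀ D ∈ admissibleVacuumData X, ∀ 𝒟 : VacuumCauchyDevelopment D, 𝒟.IsMaximal →
        ∀ (O : Set 𝒟.carrier) (τ₀ : ℝ) (U₀ : Opens E4) (Ψ₀ : U₀ → 𝒟.carrier),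
          (𝒟.toSpacetime.IsLateChart (Minkowski.backgroundOn U₀) O τ₀ Ψ₀ ∧
            {x : E4 | τ₀ < x 0} ⊆ (U₀ : Set E4) ∧
            O = Summit.FinalStateConjecture.exteriorOf 𝒟.toCauchyDevelopment
              (Ψ₀ '' (Minkowski.backgroundOn U₀).lateRegion τ₀) ∧
            (∀ τ₁ : ℝ, τ₀ < τ₁ → O \ Ψ₀ '' (Minkowski.backgroundOn U₀).lateRegion τ₁ ⊆
              𝒟.metric.causalPast 𝒟.timeOrientation
                (Ψ₀ '' (Minkowski.backgroundOn U₀).timeSlab τ₁)) ∧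
            (∀ τ : ℝ, τ₀ < τ → 𝒟.toSpacetime.deviationCk (Minkowski.backgroundOn U₀) Ψ₀ 0 τ ≤
              ENNReal.ofReal (1 / 4))) →
          (∀ x : U₀, τ₀ < x.1 0 →
            ‖𝒟.toSpacetime.deviation (Minkowski.backgroundOn U₀) Ψ₀ x‖ ≤ 1 / 4)) →
    ∀ (X : Type) [TopologicalSpace X] [ChartedSpace E3 X] [IsManifold (𝓡 3) ∞ X] [T2Space X]
      [SecondCountableTopology X] [ConnectedSpace X],
      ∀ D ∈ admissibleVacuumData X, ∀ 𝒟 : VacuumCauchyDevelopment D, 𝒟.IsMaximal →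
        ∀ (O : Set 𝒟.carrier) (τ₀ : ℝ) (U₀ : Opens E4) (Ψ₀ : U₀ → 𝒟.carrier),
          (𝒟.toSpacetime.IsLateChart (Minkowski.backgroundOn U₀) O τ₀ Ψ₀ ∧
            {x : E4 | τ₀ < x 0} ⊆ (U₀ : Set E4) ∧
            O = Summit.FinalStateConjecture.exteriorOf 𝒟.toCauchyDevelopment
              (Ψ₀ '' (Minkowski.backgroundOn U₀).lateRegion τ₀) ∧
            (∀ τ₁ : ℝ, τ₀ < τ₁ → O \ Ψ₀ '' (Minkowski.backgroundOn U₀).lateRegion τ₁ ⊆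
              𝒟.metric.causalPast 𝒟.timeOrientation
                (Ψ₀ '' (Minkowski.backgroundOn U₀).timeSlab τ₁)) ∧
            (∀ τ : ℝ, τ₀ < τ → 𝒟.toSpacetime.deviationCk (Minkowski.backgroundOn U₀) Ψ₀ 0 τ ≤
              ENNReal.ofReal (1 / 4))) →
          (∀ x : U₀, τ₀ < x.1 0 →
            𝒟.timeOrientation.IsFutureDirected
              (mfderiv 𝓘(ℝ, E4) (𝓡 4) Ψ₀ x (E4.basisVector 0))) := by
  intro hA X _ _ _ _ _ _ D hD 𝒟 hmax O τ₀ U₀ Ψ₀ hyp x hx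
  -- the pointwise anchor (neighbour `AnchorCone`, first hypothesis)
  have hdev : ∀ y : U₀, τ₀ < y.1 0 →
      ‖𝒟.toSpacetime.deviation (Minkowski.backgroundOn U₀) Ψ₀ y‖ ≤ 1 / 4 :=
    hA X D hD 𝒟 hmax O τ₀ U₀ Ψ₀ hyp
  obtain ⟨hchart, hU, hO, -, -⟩ := hyp
  -- `v y := dΨ₀(∂₀)` at `y`; uniformly timelike on the late region
  set v : ∀ y : U₀, TangentSpace (𝓡 4) (Ψ₀ y) :=
    fun y ↦ mfderiv 𝓘(ℝ, E4) (𝓡 4) Ψ₀ y (E4.basisVector 0) with hv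
  have hvt : ∀ y : U₀, τ₀ < y.1 0 → 𝒟.metric.val (Ψ₀ y) (v y) (v y) ≤ -(3 / 4) := fun y hy ↦
    val_mfderiv_basisVector_zero_le Ψ₀ y (hdev y hy)
  have hcausal : 𝒟.metric.IsCausal (v x) :=
    (show 𝒟.metric.IsTimelike (v x) from lt_of_le_of_lt (hvt x hx) (by norm_num)).isCausal
  rcases 𝒟.timeOrientation.isFutureDirected_or_isPastDirected_of_isCausal hcausal with hfut | hpast
  · exact hfut
  exfalso
  -- the vertical ray through `x`
  set δ : ℝ := x.1 0 - τ₀ with hδ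
  have hδpos : 0 < δ := sub_pos.mpr hx
  have hpt : ∀ s : ℝ, τ₀ < (x.1 + (δ * (Real.exp s - 1)) • (E4.basisVector 0 : E4)) 0 := by
    intro s
    rw [vert_apply_zero]
    have : 0 < δ * Real.exp s := mul_pos hδpos (Real.exp_pos s)
    linarith
  set c : ℝ → U₀ := fun s ↦ ⟨x.1 + (δ * (Real.exp s - 1)) • (E4.basisVector 0 : E4), hU (hpt s)⟩
    with hc
  have hcval : ∀ s : ℝ, (c s : E4) = x.1 + (δ * (Real.exp s - 1)) • (E4.basisVector 0 : E4) :=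
    fun s ↦ rfl
  have hc0 : c 0 = x := Subtype.ext (by simp [hc])
  have hclate : ∀ s : ℝ, τ₀ < (c s).1 0 := hpt
  obtain ⟨hγ, hvel⟩ := vertical_lift (𝓢 := 𝒟.toSpacetime) hchart.contMDiff x.1 δ (c := c) hcval
  set γ : ℝ → 𝒟.carrier := Ψ₀ ∘ c with hγdef
  -- speed: `g(γ', γ') = (δ eˢ)² g(v, v) ≤ -(3/4) δ²` for `s ≥ 0`
  have hspeed : ∀ s : ℝ, 0 ≤ s →
      𝒟.metric.val (γ s) (velocity (𝓡 4) γ s) (velocity (𝓡 4) γ s) ≤ -(3 / 4 * δ ^ 2) := by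
    intro s hs
    have e : 𝒟.metric.val (γ s) (velocity (𝓡 4) γ s) (velocity (𝓡 4) γ s) =
        δ * Real.exp s * (δ * Real.exp s) * 𝒟.metric.val (Ψ₀ (c s)) (v (c s)) (v (c s)) := by
      rw [(hvel s).2]
      exact val_smul_smul 𝒟.metric (γ s) (δ * Real.exp s) (v (c s))
    rw [e]
    have h1 : 𝒟.metric.val (Ψ₀ (c s)) (v (c s)) (v (c s)) ≤ -(3 / 4) := hvt (c s) (hclate s)
    have h2 : δ ≤ δ * Real.exp s := le_mul_of_one_le_right hδpos.le (Real.one_le_exp hs)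
    have h3 : 0 < δ * Real.exp s := mul_pos hδpos (Real.exp_pos s)
    have hAA : δ * δ ≤ δ * Real.exp s * (δ * Real.exp s) := mul_le_mul h2 h2 hδpos.le h3.le
    have hG : δ * Real.exp s * (δ * Real.exp s) * 𝒟.metric.val (Ψ₀ (c s)) (v (c s)) (v (c s)) ≤
        δ * Real.exp s * (δ * Real.exp s) * (-(3 / 4)) :=
      mul_le_mul_of_nonneg_left h1 (mul_self_nonneg _)
    nlinarith [hAA, hG]
  -- the velocity is timelike, hence never orthogonal to `T`
  have htl : ∀ s : ℝ, 0 ≤ s → 𝒟.metric.IsTimelike (velocity (𝓡 4) γ s) := fun s hs ↦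
    lt_of_le_of_lt (hspeed s hs) (neg_neg_of_pos (by positivity))
  -- the sign function `f(s) = g(T, γ')(s)` is continuous, nowhere zero, positive at `0`
  set f : ℝ → ℝ := fun s ↦
    𝒟.metric.val (γ s) (𝒟.timeOrientation.vectorField (γ s)) (velocity (𝓡 4) γ s) with hf
  have hcont : Continuous f :=
    (LorentzianMetric.continuous_val_snd_snd 𝒟.metric 𝒟.timeOrientation).2.comp
      (LorentzianMetric.continuous_tangentLift (hγ.of_le one_le_infty))
  have hne : ∀ s : ℝ, 0 ≤ s → f s ≠ 0 := fun s hs ↦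
    𝒟.metric.val_ne_zero_of_isTimelike_of_isCausal (𝒟.timeOrientation.isTimelike _)
      (htl s hs).isCausal
  have hf0 : 0 < f 0 := by
    have hF0 :
        0 < 𝒟.metric.val (Ψ₀ (c 0)) (𝒟.timeOrientation.vectorField (Ψ₀ (c 0))) (v (c 0)) := by
      rw [hc0]
      exact hpast.2
    have e : f 0 = δ * 𝒟.metric.val (Ψ₀ (c 0)) (𝒟.timeOrientation.vectorField (Ψ₀ (c 0)))
        (v (c 0)) := by
      simp only [hf]
      rw [(hvel 0).2, Real.exp_zero, mul_one]
      exact val_smul_right 𝒟.metric (γ 0) (𝒟.timeOrientation.vectorField (γ 0)) δ (v (c 0))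
    rw [e]
    exact mul_pos hδpos hF0
  -- hence positive on `[0, ∞)` (intermediate value theorem): the ray is past-directed throughout
  have hfpos : ∀ s : ℝ, 0 ≤ s → 0 < f s := by
    intro s hs
    by_contra hfs
    have hfs' : f s ≤ 0 := not_lt.mp hfs
    obtain ⟨r, hr, hr0⟩ := intermediate_value_Icc' hs hcont.continuousOn ⟨hfs', hf0.le⟩
    exact hne r hr.1 hr0
  -- the ray stays in the chart image, hence in `O ⊆ J⁺(Σ)`
  have hmem : ∀ s : ℝ, 0 ≤ s →
      γ s ∈ 𝒟.metric.causalFuture 𝒟.timeOrientation (range 𝒟.embed) := by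
    intro s _
    have h1 : γ s ∈ Ψ₀ '' (Minkowski.backgroundOn U₀).lateRegion τ₀ :=
      mem_image_of_mem Ψ₀ (show τ₀ < (c s).1 0 from hclate s)
    have h2 : γ s ∈ O := hchart.image_subset h1
    rw [hO] at h2
    exact h2.1
  -- contradiction with non-imprisonment (reversed orientation)
  exact false_of_pastRay_subset_causalFuture (γ := γ) two_le_infty
    𝒟.toCauchyDevelopment.isGloballyHyperbolic
    𝒟.toCauchyDevelopment.isCompact_causalPast_inter_causalFuture_range
    (k := 3 / 4 * δ ^ 2) (by positivity)
    (fun s hs ↦ ⟨(hvel s).1, hspeed s hs, (htl s hs).isCausal, hfpos s hs⟩) hmem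

end Summit.FinalStateConjecture.FinalStateConjecture.Theorems.RecurrentlyFlatDisperses

end
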